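import Mathlib
import HarnessLib
import Summits.KontsevichZagierPeriods.KontsevichZagierPeriods.Theorems.SoloInformedGaussMultFive

/-!
# SoloInformed — unit sawtooth functionals annihilate the two-term Beta lattice `V_lin(N)` at EVERY
level (level-free kernel of the placement criterion, part 1 of 2)

Context (paper/main.md §7 (c6)(ix), solo-informed). The level-specific certificates of
`SoloInformedGaussMultFive` (`N = 25`), `SoloInformedKubertLevel66`, `SoloInformedKubertLevel39` decide,
by `decide`, whether a given exponent vector lies in the two-term lattice
`V_lin(N) = ℤ⟨vec B(a,b) - vec B(c,d) : τ_{a,b} = τ_{c,d} on the units⟩` of one level. The all-level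
placement theorem of the paper ((c6-ix)(B): an identity whose vector `x` has a non-constant unit
sawtooth transform `F_x` is underivable in the Beta-binomial calculus at every level `N₀t`) rests on
ONE level-free mechanism, certified here and in `SoloInformedSawtoothDistribution` for every `N`:

* the sawtooth (first periodic Bernoulli function) `((y/N)) = y/N - 1/2` (`0 < y < N`), `((0)) = 0`
  (`soloInformedSaw`; odd: `soloInformed_saw_neg`), and the `ℤ`-linear functional
  `λ_m(v) = Σ_x v(x)·((m x/N))` (`soloInformedSawFun`);
* EVALUATION ON A BETA SYMBOL (`soloInformed_sawFun_betaVec_eq_tau`): for a unit `m` and an admissible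
  symbol (`a, b, a+b ≠ 0`), `λ_m(vec B(a,b)) = τ_{a,b}(m) - 1/2`, where `τ_{a,b}(m) ∈ {0,1}` is the
  CM-type bit (the carry `(⟨ma⟩ + ⟨mb⟩ - ⟨m(a+b)⟩)/N`, `soloInformedTauAt`; `soloInformed_tauAt_le_one`);
* hence EVERY UNIT SAWTOOTH FUNCTIONAL ANNIHILATES `V_lin(N)` (`soloInformed_sawFun_twoTermLattice`):
  two Beta symbols with the same CM type have the same `λ_m`-value for every unit `m` — at every level,
  with no enumeration;
* `λ_m` kills every reflection vector `e_a + e_{-a}` (`soloInformed_sawFun_reflVec`, any `m`);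
* consistency with the level-25 file: `soloInformedTau25 a b` is the list of `τ_{a,b}(t)` over the
  units (`soloInformed_tau25_eq_map`) and `V_lin(25)` of `SoloInformedGaussMultFive` is contained in the
  level-free `V_lin(25)` (`soloInformed_twoTermLattice25_le`), so the unit sawtooth functionals kill it.

Part 2 (`SoloInformedSawtoothDistribution`) adds Gauss's distribution relation of every index for
`((·))`, the annihilation of the standard lattice `L_N`, and the inflation compatibility
`λ_m ∘ infl_d^n = λ_{m mod d}` which is (L2) of the paper's proof. The only `decide` in this file is the
enumeration of `(ℤ/25)ˣ` used for the consistency statement: every other statement is for all `N`.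
-/

namespace Summit.KontsevichZagierPeriods.KontsevichZagierPeriods.Theorems

open Finset

/-! ## The sawtooth and the sawtooth functional -/

/-- The first periodic Bernoulli function on `ℤ/N` ("sawtooth"): `((y/N)) = y/N - 1/2` through the
canonical representative `0 < y < N`, and `((0)) = 0`. -/
def soloInformedSaw (N : ℕ) (y : ZMod N) : ℚ :=
  if y = 0 then 0 else ((y.val : ℚ) / N - 1 / 2)

/-- `((0)) = 0`. -/
@[simp] theorem soloInformed_saw_zero (N : ℕ) : soloInformedSaw N 0 = 0 := by
  simp [soloInformedSaw]

/-- The sawtooth is odd: `((-y/N)) = -((y/N))`. -/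
theorem soloInformed_saw_neg (N : ℕ) [NeZero N] (y : ZMod N) :
    soloInformedSaw N (-y) = -soloInformedSaw N y := by
  unfold soloInformedSaw
  by_cases hy : y = 0
  · simp [hy]
  · have hny : -y ≠ 0 := neg_ne_zero.mpr hy
    rw [if_neg hny, if_neg hy, ZMod.neg_val, if_neg hy]
    have hlt : y.val < N := ZMod.val_lt y
    rw [Nat.cast_sub hlt.le]
    have hN : (N : ℚ) ≠ 0 := by exact_mod_cast NeZero.ne N
    field_simp
    ring

/-- The sawtooth functional with multiplier `m`: `λ_m(v) = Σ_{x ∈ ℤ/N} v(x)·((m x/N))`, a `ℤ`-linear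
map `(ℤ/N → ℤ) → ℚ`. -/
def soloInformedSawFun (N : ℕ) [NeZero N] (m : ZMod N) : (ZMod N → ℤ) →ₗ[ℤ] ℚ where
  toFun v := ∑ x : ZMod N, (v x : ℚ) * soloInformedSaw N (m * x)
  map_add' v w := by
    simp only [Pi.add_apply, Int.cast_add, add_mul, sum_add_distrib]
  map_smul' c v := by
    simp only [Pi.smul_apply, smul_eq_mul, Int.cast_mul, RingHom.id_apply, zsmul_eq_mul, mul_sum,
      mul_assoc]

/-- Unfolding of `λ_m`. -/
theorem soloInformed_sawFun_apply (N : ℕ) [NeZero N] (m : ZMod N) (v : ZMod N → ℤ) :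
    soloInformedSawFun N m v = ∑ x : ZMod N, (v x : ℚ) * soloInformedSaw N (m * x) := rfl

/-! ## The CM-type bit of a Beta symbol -/

/-- The CM-type bit of the Beta symbol `B(a/N,b/N)` at `t ∈ ℤ/N`: the carry
`(⟨ta⟩ + ⟨tb⟩ - ⟨t(a+b)⟩)/N`. Over the units `t` this is the CM type `τ_{a,b}`; two Beta values of one
level are `ℚ̄`-proportional iff their CM types agree (Koblitz–Ogus, Wolfart–Wüstholz). -/
def soloInformedTauAt (N : ℕ) (a b t : ZMod N) : ℕ :=
  ((t * a).val + (t * b).val - (t * (a + b)).val) / N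

/-- `N · τ_{a,b}(t) = ⟨ta⟩ + ⟨tb⟩ - ⟨t(a+b)⟩`. -/
theorem soloInformed_tauAt_mul (N : ℕ) [NeZero N] (a b t : ZMod N) :
    N * soloInformedTauAt N a b t = (t * a).val + (t * b).val - (t * (a + b)).val := by
  unfold soloInformedTauAt
  rw [mul_add, ZMod.val_add]
  generalize (t * a).val + (t * b).val = s
  have h1 : s - s % N = N * (s / N) := Nat.sub_eq_of_eq_add (Nat.div_add_mod s N).symm
  rw [h1, Nat.mul_div_cancel_left _ (Nat.pos_of_ne_zero (NeZero.ne N))]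

/-- `τ_{a,b}(t) = ⌊(⟨ta⟩ + ⟨tb⟩)/N⌋`. -/
theorem soloInformed_tauAt_eq (N : ℕ) [NeZero N] (a b t : ZMod N) :
    soloInformedTauAt N a b t = ((t * a).val + (t * b).val) / N := by
  unfold soloInformedTauAt
  rw [mul_add, ZMod.val_add]
  generalize (t * a).val + (t * b).val = s
  have h1 : s - s % N = N * (s / N) := Nat.sub_eq_of_eq_add (Nat.div_add_mod s N).symm
  rw [h1, Nat.mul_div_cancel_left _ (Nat.pos_of_ne_zero (NeZero.ne N))]

/-- The CM-type bit is a bit: `τ_{a,b}(t) ≤ 1`. -/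
theorem soloInformed_tauAt_le_one (N : ℕ) [NeZero N] (a b t : ZMod N) :
    soloInformedTauAt N a b t ≤ 1 := by
  rw [soloInformed_tauAt_eq]
  have h : (t * a).val + (t * b).val < N * 2 := by
    have := ZMod.val_lt (t * a); have := ZMod.val_lt (t * b); omega
  have := Nat.div_lt_of_lt_mul h
  omega

/-- Sanity instance (`N = 7`, `B(1/7,2/7)`): `τ_{1,2}(3) = 1` (`⟨3⟩ + ⟨6⟩ - ⟨2⟩ = 7`), `τ_{1,2}(1) = 0`. -/
example : soloInformedTauAt 7 1 2 3 = 1 ∧ soloInformedTauAt 7 1 2 1 = 0 := by decide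

/-- Consistency with `SoloInformedGaussMultFive`: the level-`25` CM type is the list of CM-type bits over
the twenty units. -/
theorem soloInformed_tau25_eq_map (a b : ZMod 25) :
    soloInformedTau25 a b = soloInformedUnits25.map (soloInformedTauAt 25 a b) := rfl

/-! ## Evaluation of a sawtooth functional on a Beta symbol -/

/-- `λ_m(vec B(a,b)) = ((ma/N)) + ((mb/N)) - ((m(a+b)/N))` (any multiplier; the convention `e₀ := 0` of
`soloInformedBetaVec` is invisible because `((0)) = 0`). -/
theorem soloInformed_sawFun_betaVec (N : ℕ) [NeZero N] (m a b : ZMod N) :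
    soloInformedSawFun N m (soloInformedBetaVec N a b) =
      soloInformedSaw N (m * a) + soloInformedSaw N (m * b) - soloInformedSaw N (m * (a + b)) := by
  rw [soloInformed_sawFun_apply]
  have key : ∀ x : ZMod N, ((soloInformedBetaVec N a b x : ℤ) : ℚ) * soloInformedSaw N (m * x) =
      ((if a = x then soloInformedSaw N (m * x) else 0) +
        (if b = x then soloInformedSaw N (m * x) else 0)) -
        (if a + b = x then soloInformedSaw N (m * x) else 0) := by
    intro x
    unfold soloInformedBetaVec
    by_cases hx : x = 0
    · subst hx
      simp
    · simp only [hx, ne_eq, not_false_eq_true, and_true]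
      split_ifs <;> push_cast <;> ring
  rw [sum_congr rfl fun x _ => key x, sum_sub_distrib, sum_add_distrib]
  simp only [sum_ite_eq, mem_univ, if_true]

/-- EVALUATION ON A BETA SYMBOL. For a unit `m` and an admissible symbol (`a, b, a+b ≠ 0`):
`λ_m(vec B(a,b)) = τ_{a,b}(m) - 1/2`. -/
theorem soloInformed_sawFun_betaVec_eq_tau (N : ℕ) [NeZero N] {m : ZMod N} (hm : IsUnit m)
    {a b : ZMod N} (ha : a ≠ 0) (hb : b ≠ 0) (hab : a + b ≠ 0) :
    soloInformedSawFun N m (soloInformedBetaVec N a b) = (soloInformedTauAt N a b m : ℚ) - 1 / 2 := by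
  rw [soloInformed_sawFun_betaVec]
  have h1 : m * a ≠ 0 := fun h => ha (hm.mul_right_eq_zero.mp h)
  have h2 : m * b ≠ 0 := fun h => hb (hm.mul_right_eq_zero.mp h)
  have h3 : m * (a + b) ≠ 0 := fun h => hab (hm.mul_right_eq_zero.mp h)
  simp only [soloInformedSaw, if_neg h1, if_neg h2, if_neg h3]
  have key := soloInformed_tauAt_mul N a b m
  have hle : (m * (a + b)).val ≤ (m * a).val + (m * b).val := by
    rw [mul_add, ZMod.val_add]; exact Nat.mod_le _ _
  have keyQ : (N : ℚ) * (soloInformedTauAt N a b m : ℚ) =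
      ((m * a).val : ℚ) + ((m * b).val : ℚ) - ((m * (a + b)).val : ℚ) := by
    have := congrArg (Nat.cast : ℕ → ℚ) key
    push_cast [Nat.cast_sub hle] at this
    exact this
  have hN : (N : ℚ) ≠ 0 := by exact_mod_cast NeZero.ne N
  have ht : (soloInformedTauAt N a b m : ℚ) =
      (((m * a).val : ℚ) + ((m * b).val : ℚ) - ((m * (a + b)).val : ℚ)) / N := by
    rw [eq_div_iff hN]; linarith [keyQ]
  rw [ht]
  field_simp
  ring

/-! ## The two-term lattice `V_lin(N)` and its annihilation by unit sawtooth functionals -/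

/-- Generators of the two-term lattice at level `N`: `vec B(a,b) - vec B(c,d)` for admissible symbols with
the same CM type (equal CM-type bits at every unit) — the exponent vectors of the true `ℚ̄`-linear
relations between TWO Beta values of level `N` (each a `Rung₂` instance, decided granted Huber–Wüstholz). -/
def soloInformedTwoTermGen (N : ℕ) : Set (ZMod N → ℤ) :=
  {v | ∃ a b c d : ZMod N, (a ≠ 0 ∧ b ≠ 0 ∧ a + b ≠ 0) ∧ (c ≠ 0 ∧ d ≠ 0 ∧ c + d ≠ 0) ∧
      (∀ t : ZMod N, IsUnit t → soloInformedTauAt N a b t = soloInformedTauAt N c d t) ∧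
      v = soloInformedBetaVec N a b - soloInformedBetaVec N c d}

/-- The two-term lattice `V_lin(N)`: a factorwise (E1/E2) derivation changes the exponent vector of a
state only inside this lattice. -/
def soloInformedTwoTermLattice (N : ℕ) : Submodule ℤ (ZMod N → ℤ) :=
  Submodule.span ℤ (soloInformedTwoTermGen N)

/-- A unit sawtooth functional vanishes on every two-term generator. -/
theorem soloInformed_sawFun_twoTermGen (N : ℕ) [NeZero N] {m : ZMod N} (hm : IsUnit m) :
    ∀ v ∈ soloInformedTwoTermGen N, soloInformedSawFun N m v = 0 := by
  rintro v ⟨a, b, c, d, ⟨ha, hb, hab⟩, ⟨hc, hd, hcd⟩, htau, rfl⟩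
  rw [map_sub, soloInformed_sawFun_betaVec_eq_tau N hm ha hb hab,
    soloInformed_sawFun_betaVec_eq_tau N hm hc hd hcd, htau m hm, sub_self]

/-- LEVEL-FREE ANNIHILATION. Every unit sawtooth functional `λ_m` (`m ∈ (ℤ/N)ˣ`) annihilates the
two-term lattice `V_lin(N)`, at every level `N`. -/
theorem soloInformed_sawFun_twoTermLattice (N : ℕ) [NeZero N] {m : ZMod N} (hm : IsUnit m) :
    ∀ v ∈ soloInformedTwoTermLattice N, soloInformedSawFun N m v = 0 := by
  intro v hv
  have h : soloInformedTwoTermLattice N ≤ LinearMap.ker (soloInformedSawFun N m) :=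
    Submodule.span_le.mpr fun w hw => LinearMap.mem_ker.mpr (soloInformed_sawFun_twoTermGen N hm w hw)
  exact LinearMap.mem_ker.mp (h hv)

/-- The units of `ℤ/25` are among the twenty residues listed in `soloInformedUnits25`. -/
theorem soloInformed_isUnit25_mem (t : ZMod 25) (ht : IsUnit t) : t ∈ soloInformedUnits25 := by
  have hc : t.val.Coprime 25 := by
    have h := (ZMod.isUnit_iff_coprime t.val 25).mp (by rwa [ZMod.natCast_zmod_val])
    exact h
  revert hc
  revert t
  decide

/-- Consistency: the level-`25` two-term lattice of `SoloInformedGaussMultFive` is contained in the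
level-free one (so the unit sawtooth functionals annihilate it). -/
theorem soloInformed_twoTermLattice25_le :
    soloInformedTwoTermLattice25 ≤ soloInformedTwoTermLattice 25 := by
  apply Submodule.span_mono
  rintro v ⟨a, b, c, d, hab, hcd, htau, rfl⟩
  refine ⟨a, b, c, d, hab, hcd, ?_, rfl⟩
  intro t ht
  have hmem := soloInformed_isUnit25_mem t ht
  rw [soloInformed_tau25_eq_map, soloInformed_tau25_eq_map, List.map_inj_left] at htau
  exact htau t hmem

/-! ## Reflection and distribution vectors: `λ_m` annihilates the standard lattice `L_N` -/

/-- `λ_m(e_a + e_{-a}) = 0` for every multiplier `m` (oddness). -/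
theorem soloInformed_sawFun_reflVec (N : ℕ) [NeZero N] (m a : ZMod N) :
    soloInformedSawFun N m (soloInformedReflVec N a) = 0 := by
  rw [soloInformed_sawFun_apply]
  simp only [soloInformedReflVec, Int.cast_add, Int.cast_ite, Int.cast_one, Int.cast_zero, add_mul,
    ite_mul, one_mul, zero_mul, sum_add_distrib, sum_ite_eq, mem_univ, if_true]
  rw [mul_neg, soloInformed_saw_neg, add_neg_cancel]

end Summit.KontsevichZagierPeriods.KontsevichZagierPeriods.Theorems
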